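import Literature.MathematicalPhysics.QuantumFieldTheory.Balaban1983to89.B9Eq3105TAtLetters
import Literature.MathematicalPhysics.QuantumFieldTheory.Balaban1983to89.B9CubeBondRowAgreementNearH

/-!
# `Balaban1983to89.B9Eq3105TAtLettersNearH` — T. Bałaban, *Propagators for lattice gauge theories in a background field*, Commun. Math. Phys. **99** (1985)
# 389–434 [Balaban1985BackgroundPropagators], (3.105) p. 414 TRANSPOSED at def-Y's letters with the COLUMN-AGREEMENT HYPOTHESIS DISCHARGED: the column twin of
# r05's `B9CubeBondRowAgreementNearH.QsaQCubeY_apply_eq_of_hT` and the hypothesis-light `eq3105T` identity (sub-row G-B9-LETTERS, module M5.7 «(3.105) assembly»,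
# sequel of `B9Eq3105TAtLetters`)

statement-level skeleton of published theorems with citation tags; proofs where landed; nothing here is a claim about the Yang–Mills mass gap

PDF held: `paper:balaban1985-cmp99-background-propagators` (journal page = PDF page + 388).  p. 414 (3.105) «Δ_aG₀ = I − Σ_□K(h_□)G_□h_□ − … = I − R» and «Similarly
for averaging operators»; p. 409 l.3–5 «The operators constructed for this sequence, which we denote by G′_□(U), C_□(U) = (Q(U)G′_□²(U)Q*(U))⁻¹, G_□(U), satisfy all the
inequalities of Theorems 3.1–3.3 correspondingly»; p. 408 «Ω_n(□) ⊂ Ω_n»; [4] (2.20) p. 226 «(QA)(b) = (Q_jA)(b) for b ∈ Λ_j».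

WHAT THIS FILE PROVES (all `theorem`s, 0 `def … : Prop`, 0 sorry).
* §1 ★ `QsaQCubeY_apply_eq_of_input` — r05's bijection `B9CubeBondRowAgreement.QsaQCubeY_apply_eq` RE-KEYED ON THE INPUT: if every index bond (of either sequence)
  whose block meets `supp A` is an index bond of the other sequence, then `(Q*_□(U)a_□Q_□(U)A)(f) = (Q*(U)aQ(U)A)(f)` at EVERY fine bond `f` (a summand of the normal
  form that does not vanish sees a bond `f′` with `A(f′) ≠ 0`); ★★ `QsaQCubeY_cutMulY_hT_apply_eq` — for inputs cut off by `h_□ = hT`, at every output bond (r05's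
  `rows_agree_of_hT` at the input bonds).
* §2 ★★ `eq3105T_hT_GACubeY_of_hT` — `G₀Δ_a = 1 − R♯` at def-Y's `deltaAY`, the partition of record, r05's `G_□(U) = Δ_{a,□}(U)⁻¹`, `DP_□D*`, `P_{□,1}`, ANY
  `ζ_□̃ = 1 on supp h_□`, under ONLY `∀ □, IsUnit (Δ_{a,□}(U))`; `fixedPoint3105T_hT_GACubeY_of_hT` — `G = G₀ + R♯·G` for any right inverse `G` of `Δ_a(U)`.
HONEST SCOPE.  As the parent: an identity, no estimate; print displays only the left (3.105); `IsUnit (Δ_{a,□}(U))` at curved `U` stays a HYPOTHESIS (Thm 3.11 for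
the cube letters); nothing continuum ∕ OS ∕ mass gap ∕ Clay; YM mass gap NOT proved by any of this (Track A conditional rung).  `--supports stmt-QuantumFields-19200`.
Net new unproved facts: 0.
-/

noncomputable section

namespace Literature.MathematicalPhysics.QuantumFieldTheory.Balaban1983to89.B9Eq3105TAtLettersNearH

open Node00
open B9Thm37CubeCoverCommutators (cutMulY cutMulY_apply hTY hTY_apply)
open B9Eq3104CutoffCommutators (hBdY hBdY_apply KhBY DPDsY)
open B9CubeLettersBondOpsL0 (IBondCubeY qKc qTc QCubeY QsCubeY aCubeY deltaACubeY GACubeY)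
open B9CubeBondWeights (domCube wCubeBond)
open B9CubeBondRowAgreement (QsaQCubeY_apply QsaQY_apply summand_eq)
open B9CubeBondRowAgreementNearH (rows_agree_of_hT)
open B9Eq3105AtLetters (DPDsCubeY P1CubeY)
open B9Eq3105TAtLetters (eq3105T_hT_GACubeY fixedPoint3105T_hT_GACubeY)
open B6KLevelCensusIndexV1 (KIdx)
open B6Cover236MultiLevelBlocks (cubes)
open B6GlobalChartV1 (PV domT toBox)
open B6Partition118KLevelTorus (hT)
open Node00.OpsYNablaBridge (chartY)
open B9Eq39Adjoint (R R_zero)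
open scoped Matrix

variable {d ℓ : ℕ} {hd : 1 ≤ d + 1} {hL : Odd (ℓ + 1) ∧ 1 < ℓ + 1} {b₀ b₁ : ℝ}
variable {𝔸 : Type} [NormedRing 𝔸] [NormedAlgebra ℂ 𝔸] [CompleteSpace 𝔸]
variable (i : KIdx d ℓ hd hL b₀ b₁)

/-! ## §1 The column agreement of `Q*(U)aQ(U)`: inputs supported where the two index-bond sets agree -/

section Column

variable (q : ↥(cubes (toKT i).D.toDomains))

/-- ★ **THE BOND-SECTOR COLUMN AGREEMENT** (r05's bijection re-keyed on the input): if every index bond of the cube sequence whose block meets `supp A` is an index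
bond of the member and vice versa, then `(Q*_□(U)a_□Q_□(U)A)(f) = (Q*(U)aQ(U)A)(f)` at EVERY fine bond `f` — every `U`, every contour-transporter table.
[cite: Balaban1985BackgroundPropagators, p.409 l.3–5, (3.105) p.414 («Similarly for averaging operators»); Balaban1984PropagatorsII, (2.3) p.224, (2.20) p.226] -/
theorem QsaQCubeY_apply_eq_of_input (parB : BondParY 𝔸 i) (U : CfgY 𝔸 i) (A : FBondY i → 𝔸) (f : FBondY i)
    (h1 : ∀ (ι : IBondCubeY i q) (f' : FBondY i), qKc i q ι f' ≠ 0 → A f' ≠ 0 → (domT i.hN i.D i.hk).LamBond (ι.1.1 : ℕ) ι.1.2)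
    (h2 : ∀ (ι : IBondY i) (f' : FBondY i), qK i ι f' ≠ 0 → A f' ≠ 0 → (domCube i q).LamBond (ι.1.1 : ℕ) ι.1.2) :
    QsCubeY i q parB U (aCubeY i q (QCubeY i q parB U A)) f = QsY i parB U (aY i (QY i parB U A)) f := by
  classical
  rw [QsaQCubeY_apply, QsaQY_apply]
  -- a non-vanishing summand sees an input bond `f'` with `A f' ≠ 0` in its block
  have hne1 : ∀ ι : IBondCubeY i q,
      ((qKc i q ι f : ℝ) : ℂ) • R ((qTc i q parB U ι f)⁻¹)
        ((((wCubeBond i q ι : ℝ) : ℂ)) • ∑ f', ((qKc i q ι f' : ℝ) : ℂ) • R (qTc i q parB U ι f') (A f')) ≠ 0 →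
        ∃ f', qKc i q ι f' ≠ 0 ∧ A f' ≠ 0 := by
    intro ι hne
    by_contra hall
    push Not at hall
    apply hne
    have h0 : ∑ f', ((qKc i q ι f' : ℝ) : ℂ) • R (qTc i q parB U ι f') (A f') = 0 := by
      refine Finset.sum_eq_zero fun f' _ => ?_
      by_cases hq : qKc i q ι f' = 0
      · rw [hq, Complex.ofReal_zero, zero_smul]
      · rw [hall f' hq, R_zero, smul_zero]
    rw [h0, smul_zero, R_zero, smul_zero]
  have hne2 : ∀ ι : IBondY i,
      ((qK i ι f : ℝ) : ℂ) • R ((qT i parB U ι f)⁻¹)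
        ((((i.w ι : ℝ) : ℂ)) • ∑ f', ((qK i ι f' : ℝ) : ℂ) • R (qT i parB U ι f') (A f')) ≠ 0 →
        ∃ f', qK i ι f' ≠ 0 ∧ A f' ≠ 0 := by
    intro ι hne
    by_contra hall
    push Not at hall
    apply hne
    have h0 : ∑ f', ((qK i ι f' : ℝ) : ℂ) • R (qT i parB U ι f') (A f') = 0 := by
      refine Finset.sum_eq_zero fun f' _ => ?_
      by_cases hq : qK i ι f' = 0
      · rw [hq, Complex.ofReal_zero, zero_smul]
      · rw [hall f' hq, R_zero, smul_zero]
    rw [h0, smul_zero, R_zero, smul_zero]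
  have hD : ∀ ι : IBondCubeY i q,
      ((qKc i q ι f : ℝ) : ℂ) • R ((qTc i q parB U ι f)⁻¹)
        ((((wCubeBond i q ι : ℝ) : ℂ)) • ∑ f', ((qKc i q ι f' : ℝ) : ℂ) • R (qTc i q parB U ι f') (A f')) ≠ 0 →
        (domT i.hN i.D i.hk).LamBond (ι.1.1 : ℕ) ι.1.2 :=
    fun ι hne => (hne1 ι hne).elim fun f' hf' => h1 ι f' hf'.1 hf'.2
  have hF : ∀ ι : IBondY i,
      ((qK i ι f : ℝ) : ℂ) • R ((qT i parB U ι f)⁻¹)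
        ((((i.w ι : ℝ) : ℂ)) • ∑ f', ((qK i ι f' : ℝ) : ℂ) • R (qT i parB U ι f') (A f')) ≠ 0 →
        (domCube i q).LamBond (ι.1.1 : ℕ) ι.1.2 :=
    fun ι hne => (hne2 ι hne).elim fun f' hf' => h2 ι f' hf'.1 hf'.2
  refine Finset.sum_bij_ne_zero (fun ι _ hne => (⟨ι.1, hD ι hne⟩ : IBondY i)) (fun _ _ _ => Finset.mem_univ _)
    (fun ι₁ _ _ ι₂ _ _ heq => by have h := Subtype.ext_iff.1 heq; exact Subtype.ext h) (fun ι' _ hne' => ?_) (fun ι _ hne => ?_)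
  · refine ⟨⟨ι'.1, hF ι' hne'⟩, Finset.mem_univ _, ?_, rfl⟩
    rw [summand_eq i q parB U A f ι'.1 (hF ι' hne') ι'.2]
    exact hne'
  · exact summand_eq i q parB U A f ι.1 ι.2 (hD ι hne)

/-- ★★ **THE COLUMN AGREEMENT FOR INPUTS CUT OFF BY `h^T_□`**: `(Q*_□(U)a_□Q_□(U)(h_□·A))(f) = (Q*(U)aQ(U)(h_□·A))(f)` at EVERY fine bond `f` (r05's `rows_agree_of_hT` at the
input bonds `f′` with `h_□(f′₋) ≠ 0`). [cite: Balaban1985BackgroundPropagators, p.409 l.3–5, (3.105) p.414, p.408 («Ω_n(□) ⊂ Ω_n»); Balaban1984PropagatorsII, (2.20) p.226] -/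
theorem QsaQCubeY_cutMulY_hT_apply_eq (parB : BondParY 𝔸 i) (U : CfgY 𝔸 i) (A : FBondY i → 𝔸) (f : FBondY i) :
    QsCubeY i q parB U (aCubeY i q (QCubeY i q parB U (cutMulY (hBdY i (hTY i q)) A))) f =
      QsY i parB U (aY i (QY i parB U (cutMulY (hBdY i (hTY i q)) A))) f := by
  have hcut : ∀ f' : FBondY i, cutMulY (𝔸 := 𝔸) (hBdY i (hTY i q)) A f' ≠ 0 → hT (toKT i).D q (toBox i.hN f'.src) ≠ 0 := by
    intro f' hne h0
    apply hne
    rw [cutMulY_apply, hBdY_apply]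
    show ((hT i.D q (toBox i.hN f'.src) : ℝ) : ℂ) • A f' = 0
    rw [show hT i.D q (toBox i.hN f'.src) = 0 from h0, Complex.ofReal_zero, zero_smul]
  exact QsaQCubeY_apply_eq_of_input i q parB U _ f (fun ι f' hq hA => (rows_agree_of_hT i q f' (hcut f' hA)).1 ι hq)
    (fun ι f' hq hA => (rows_agree_of_hT i q f' (hcut f' hA)).2 ι hq)

end Column

/-! ## §2 The transposed (3.105) with the column agreement discharged -/

section Record

/-- ★★ **(3.105) TRANSPOSED AT def-Y's LETTERS, COLUMN AGREEMENT DISCHARGED**: `h_□ = hTY i □`, `G_□(U) = GACubeY i □ parS parB U`, `DP_□D*(U) = DPDsCubeY i □ parS U`,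
`P_{□,1}(∂h_□)(U) = P1CubeY i □ (hTY i □) parS U`, ANY cut-offs `ζ_□̃ = 1` on `supp h_□`, every `Δ_{a,□}(U)` invertible:
`(Σ_□ h_□G_□(U)h_□)·Δ_a(U) = 1 + Σ_□ h_□G_□(U)K(h_□)(U) + Σ_□ h_□G_□(U)P_{□,1}(∂h_□)(U) − Σ_□ (h_□G_□(U)h_□)·ζ_□̃(DPD*(U) − DP_□D*(U)) − Σ_□ (h_□G_□(U)h_□)·(1 − ζ_□̃)DPD*(U)`.
[cite: Balaban1985BackgroundPropagators, (3.105) p.414 (transposed), (3.87) p.409, p.408, p.409 l.3–5] -/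
theorem eq3105T_hT_GACubeY_of_hT (parS : SiteParY 𝔸 i) (parB : BondParY 𝔸 i) (Gp : SiteOpY 𝔸 i) (U : CfgY 𝔸 i)
    (ζ : ↥(cubes i.D.toDomains) → SiteY i → ℝ) (hζ : ∀ c z, hTY i c z ≠ 0 → ζ c z = 1)
    (hinv : ∀ c : ↥(cubes i.D.toDomains), IsUnit (deltaACubeY i c parS parB U)) :
    (∑ c, cutMulY (hBdY i (hTY i c)) * GACubeY i c parS parB U * cutMulY (hBdY i (hTY i c))) * deltaAY i parS parB Gp U =
      1 + ∑ c, cutMulY (hBdY i (hTY i c)) * GACubeY i c parS parB U * KhBY i (hTY i c) parB U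
        + ∑ c, cutMulY (hBdY i (hTY i c)) * GACubeY i c parS parB U * P1CubeY i c (hTY i c) parS U
        - ∑ c, cutMulY (hBdY i (hTY i c)) * GACubeY i c parS parB U * cutMulY (hBdY i (hTY i c)) *
            (cutMulY (hBdY i (ζ c)) * (DPDsY i parS Gp U - DPDsCubeY i c parS U))
        - ∑ c, cutMulY (hBdY i (hTY i c)) * GACubeY i c parS parB U * cutMulY (hBdY i (hTY i c)) *
            ((1 - cutMulY (hBdY i (ζ c))) * DPDsY i parS Gp U) :=
  eq3105T_hT_GACubeY i parS parB Gp U ζ hζ hinv fun c A f => QsaQCubeY_cutMulY_hT_apply_eq i c parB U A f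

/-- ★ the LEFT fixed point `G = G₀ + R♯·G` for any right inverse `G` of `Δ_a(U)`, column agreement discharged. [cite: Balaban1985BackgroundPropagators, (3.105)–(3.106) p.414 (transposed), (3.87) p.409] -/
theorem fixedPoint3105T_hT_GACubeY_of_hT (parS : SiteParY 𝔸 i) (parB : BondParY 𝔸 i) (Gp : SiteOpY 𝔸 i) (U : CfgY 𝔸 i)
    (ζ : ↥(cubes i.D.toDomains) → SiteY i → ℝ) (hζ : ∀ c z, hTY i c z ≠ 0 → ζ c z = 1)
    (hinv : ∀ c : ↥(cubes i.D.toDomains), IsUnit (deltaACubeY i c parS parB U))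
    {G : Module.End ℂ (FBondY i → 𝔸)} (hG : deltaAY i parS parB Gp U * G = 1) :
    G = (∑ c, cutMulY (hBdY i (hTY i c)) * GACubeY i c parS parB U * cutMulY (hBdY i (hTY i c)))
      + (-(∑ c, cutMulY (hBdY i (hTY i c)) * GACubeY i c parS parB U * KhBY i (hTY i c) parB U)
          - ∑ c, cutMulY (hBdY i (hTY i c)) * GACubeY i c parS parB U * P1CubeY i c (hTY i c) parS U
          + ∑ c, cutMulY (hBdY i (hTY i c)) * GACubeY i c parS parB U * cutMulY (hBdY i (hTY i c)) *
              (cutMulY (hBdY i (ζ c)) * (DPDsY i parS Gp U - DPDsCubeY i c parS U))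
          + ∑ c, cutMulY (hBdY i (hTY i c)) * GACubeY i c parS parB U * cutMulY (hBdY i (hTY i c)) *
              ((1 - cutMulY (hBdY i (ζ c))) * DPDsY i parS Gp U)) * G :=
  fixedPoint3105T_hT_GACubeY i parS parB Gp U ζ hζ hinv (fun c A f => QsaQCubeY_cutMulY_hT_apply_eq i c parB U A f) hG

end Record

end Literature.MathematicalPhysics.QuantumFieldTheory.Balaban1983to89.B9Eq3105TAtLettersNearH

end
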